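import Summits.AtomisticToContinuum.FouriersLaw.Theorems.BondHeatUncertaintySubdiffusiveBondHeatKernelGibbsC
import Literature.MathematicalPhysics.KineticTheory.SdeGeneratorCalculus

/-!
# Uniqueness of the weak steady state (`NessUnique`), part 8: Duhamel's formula for the reversed kernels

Support file for item `stmt-AtomisticToContinuum-0741` (`EmbeddedDrudeMourre.NessUnique`). For a chain with smooth
confining potentials (`N ≥ 1`), the transition kernels `P̂_t` of the time-reversed Langevin equation
(`OscillatorChain.langevinRevKernel`) and any `f ∈ C²_c` with stationary defect `E = L̂ f + 2γ f`:

* `revKernel_duhamel` — **`e^{2γt} P̂_t f(y) - f(y) = ∫₀ᵗ e^{2γs} P̂_s E(y) ds`** (Dynkin's identity for the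
  reversed equation, `RegularConfinedDrift.sdeKernel_dynkin`, and the integrating factor `e^{2γs}`);
* `lintegral_revKernel_le` — Lebesgue measure is `e^{-2γt}`-contracted by `P̂_t`:
  `∫ dy ∫ g dP̂_t(y, ·) ≤ ∫ g dx` for measurable `g ≥ 0`, `t > 0` (duality `dx P_t(x,dy) = e^{2γt} dy P̂_t(y,dx)`);
* `lintegral_abs_duhamel_le` — hence **`∫ |e^{2γt} P̂_t f - f| dy ≤ e^{2γt} t ‖E‖_{L¹}`**.
-/

noncomputable section

open MeasureTheory ProbabilityTheory Filter Topology Set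
open scoped NNReal ENNReal ContDiff

namespace Summit.AtomisticToContinuum.FouriersLaw.Theorems.NessUnique

open Literature.MathematicalPhysics.KineticTheory.HeatConduction
open Literature.MathematicalPhysics.KineticTheory Literature.Probability.Process OscillatorChain
open Summit.AtomisticToContinuum.FouriersLaw.Theorems.SubdiffusiveBondHeat

variable {N : ℕ} {P : OscillatorChain}

section Duhamel

variable (T_L T_R : ℝ)

/-- **Duhamel's formula for the reversed kernels**: for `f ∈ C²_c`, `t ≥ 0` and every `y`,
`e^{2γt} ∫ f dP̂_t(y,·) - f(y) = ∫₀ᵗ e^{2γs} ∫ (L̂ f + 2γ f) dP̂_s(y,·) ds`. [folklore] -/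
theorem revKernel_duhamel (hP : P.IsConfining) {f : PhaseSpace N → ℝ} (hf : ContDiff ℝ 2 f) (hfc : HasCompactSupport f)
    (t : ℝ≥0) (y : PhaseSpace N) :
    Real.exp (2 * P.γ * t) * ∫ x, f x ∂(P.langevinRevKernel N T_L T_R t y) - f y =
      ∫ s in (0 : ℝ)..(t : ℝ), Real.exp (2 * P.γ * s) *
        ∫ x, (sdeGenerator (fun z => -P.drift N z) (P.bathVecL N T_L) (P.bathVecR N T_R) f x + 2 * P.γ * f x)
          ∂(P.langevinRevKernel N T_L T_R s.toNNReal y) := by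
  set D := hP.reversedDrift N with hD
  have hv₁ := hP.bathVecL_mem_reversedDrift_noise N T_L
  have hv₂ := hP.bathVecR_mem_reversedDrift_noise N T_R
  set κ : ℝ≥0 → Kernel (PhaseSpace N) (PhaseSpace N) := P.langevinRevKernel N T_L T_R with hκ
  have hκs : ∀ s, κ s = sdeKernel (fun z => -P.drift N z) (P.bathVecL N T_L) (P.bathVecR N T_R) s := fun s => rfl
  haveI hprob : ∀ s z, IsProbabilityMeasure (κ s z) := fun s z =>
    isProbabilityMeasure_langevinRevKernel hP N T_L T_R s z
  set Lf := sdeGenerator (fun z => -P.drift N z) (P.bathVecL N T_L) (P.bathVecR N T_R) f with hLf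
  set c := 2 * P.γ with hc
  have hYc : Continuous fun z => -P.drift N z := D.contDiff_drift.continuous
  have hfcont : Continuous f := hf.continuous
  have hLc : Continuous Lf := continuous_sdeGenerator _ _ hYc hf
  obtain ⟨Cf, hCf⟩ := hfcont.bounded_above_of_compact_support hfc
  obtain ⟨CL, hCL⟩ := exists_bound_sdeGenerator (P.bathVecL N T_L) (P.bathVecR N T_R) hYc hf hfc
  set E : PhaseSpace N → ℝ := fun x => Lf x + c * f x with hE
  have hEc : Continuous E := hLc.add (continuous_const.mul hfcont)
  have hEb : ∀ x, ‖E x‖ ≤ CL + |c| * Cf := fun x => by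
    calc ‖E x‖ ≤ ‖Lf x‖ + ‖c * f x‖ := norm_add_le _ _
      _ ≤ CL + |c| * Cf := by
          rw [norm_mul, Real.norm_eq_abs]
          exact add_le_add (hCL x) (mul_le_mul_of_nonneg_left (hCf x) (abs_nonneg c))
  -- the three time functions
  set Φ : ℝ → ℝ := fun s => ∫ x, f x ∂(κ s.toNNReal y) with hΦ
  set Ψ : ℝ → ℝ := fun s => ∫ x, Lf x ∂(κ s.toNNReal y) with hΨ
  set e : ℝ → ℝ := fun s => ∫ x, E x ∂(κ s.toNNReal y) with he
  have hΦc : Continuous Φ := continuous_integral_langevinRevKernel hP N T_L T_R y hfcont hCf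
  have hΨc : Continuous Ψ := continuous_integral_langevinRevKernel hP N T_L T_R y hLc hCL
  have hec : Continuous e := continuous_integral_langevinRevKernel hP N T_L T_R y hEc hEb
  have he_eq : ∀ s, e s = Ψ s + c * Φ s := by
    intro s
    have i1 : Integrable Lf (κ s.toNNReal y) :=
      (integrable_const CL).mono' hLc.aestronglyMeasurable (Eventually.of_forall hCL)
    have i2 : Integrable f (κ s.toNNReal y) :=
      (integrable_const Cf).mono' hfcont.aestronglyMeasurable (Eventually.of_forall hCf)
    simp only [he, hΨ, hΦ, hE]
    rw [integral_add i1 (i2.const_mul c), integral_const_mul]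
  -- Dynkin for the reversed equation
  have hdyn : ∀ u : ℝ, 0 ≤ u → Φ u - f y = ∫ s in (0:ℝ)..u, Ψ s := by
    intro u hu
    have h := D.sdeKernel_dynkin hv₁ hv₂ hf hfc u.toNNReal y
    rw [Real.coe_toNNReal _ hu, ← hκs] at h
    simp only [hΦ, hΨ]
    rw [h]
    refine intervalIntegral.integral_congr fun s _ => ?_
    rw [← hκs]
  have hΦ0 : Φ 0 = f y := sub_eq_zero.1 (by simpa using hdyn 0 le_rfl)
  -- the integrating factor
  set G : ℝ → ℝ := fun s => Real.exp (c * s) * Φ s with hG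
  have hGc : Continuous G := (Real.continuous_exp.comp (continuous_const.mul continuous_id)).mul hΦc
  have hGderiv : ∀ x : ℝ, 0 ≤ x → HasDerivWithinAt G (Real.exp (c * x) * e x) (Ici x) x := by
    intro x hx0
    have hΦd : HasDerivWithinAt Φ (Ψ x) (Ici x) x := by
      have hF : HasDerivAt (fun s => f y + ∫ r in (0:ℝ)..s, Ψ r) (Ψ x) x :=
        (hΨc.integral_hasStrictDerivAt 0 x).hasDerivAt.const_add (f y)
      refine hF.hasDerivWithinAt.congr (fun s hs => ?_) ?_
      · have := hdyn s (hx0.trans hs); linarith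
      · have := hdyn x hx0; linarith
    have hexp : HasDerivWithinAt (fun s => Real.exp (c * s)) (Real.exp (c * x) * c) (Ici x) x := by
      have h1 : HasDerivAt (fun s : ℝ => c * s) c x := by simpa using (hasDerivAt_id x).const_mul c
      exact h1.exp.hasDerivWithinAt
    have := hexp.mul hΦd
    refine this.congr_deriv ?_
    rw [he_eq x]; ring
  -- fundamental theorem of calculus on `[0, t]`
  have hftc : ∫ s in (0:ℝ)..(t:ℝ), Real.exp (c * s) * e s = G t - G 0 := by
    refine intervalIntegral.integral_eq_sub_of_hasDeriv_right_of_le t.coe_nonneg hGc.continuousOn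
      (fun x hx => (hGderiv x hx.1.le).mono Set.Ioi_subset_Ici_self) ?_
    exact ((Real.continuous_exp.comp (continuous_const.mul continuous_id)).mul hec).intervalIntegrable _ _
  have hGt : G t = Real.exp (c * t) * ∫ x, f x ∂(κ t y) := by
    simp only [hG, hΦ, Real.toNNReal_coe]
  have hG0 : G 0 = f y := by simp only [hG]; rw [mul_zero, Real.exp_zero, one_mul, hΦ0]
  rw [hGt, hG0] at hftc
  rw [← hftc]

/-- **Lebesgue measure is contracted by the reversed kernels**: `∫ dy ∫ g dP̂_t(y,·) ≤ ∫ g dx` for measurable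
`g ≥ 0` and `t > 0` (the duality `dx P_t(x,dy) = e^{2γt} dy P̂_t(y,dx)` of `LangevinChainReversal`, `e^{2γt} ≥ 1`).
[folklore] -/
theorem lintegral_revKernel_le (hP : P.IsConfining) (hU : ContDiff ℝ ((⊤ : ℕ∞) : WithTop ℕ∞) P.U)
    (hV : ContDiff ℝ ((⊤ : ℕ∞) : WithTop ℕ∞) P.V) (hN : 0 < N) {t : ℝ≥0} (ht : 0 < t)
    {g : PhaseSpace N → ℝ≥0∞} (hg : Measurable g) :
    ∫⁻ y, ∫⁻ x, g x ∂(P.langevinRevKernel N T_L T_R t y) ≤ ∫⁻ x, g x := by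
  haveI : ∀ x, IsProbabilityMeasure (P.langevinKernel N T_L T_R t x) := fun x =>
    (hP.isMarkovKernel_langevinKernel N T_L T_R t).isProbabilityMeasure x
  have hdual := hP.lintegral_langevinKernel_duality (T_L := T_L) (T_R := T_R) hU hV hN ht
    (H := fun p : PhaseSpace N × PhaseSpace N => g p.1) (hg.comp measurable_fst)
  simp only [lintegral_const, measure_univ, mul_one] at hdual
  have h1 : (1 : ℝ≥0∞) ≤ ENNReal.ofReal (Real.exp (2 * P.γ * t)) := by
    rw [← ENNReal.ofReal_one]
    exact ENNReal.ofReal_le_ofReal (Real.one_le_exp (by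
      have := hP.γ_nonneg; have := t.coe_nonneg; positivity))
  calc ∫⁻ y, ∫⁻ x, g x ∂(P.langevinRevKernel N T_L T_R t y)
      ≤ ENNReal.ofReal (Real.exp (2 * P.γ * t)) * ∫⁻ y, ∫⁻ x, g x ∂(P.langevinRevKernel N T_L T_R t y) :=
        le_mul_of_one_le_left' h1
    _ = ∫⁻ x, g x := hdual.symm

/-- Joint measurability of `(t, y) ↦ P̂_t(y, ·)`. [folklore] -/
theorem measurable_langevinRevKernel (hP : P.IsConfining) :
    Measurable fun q : ℝ≥0 × PhaseSpace N => P.langevinRevKernel N T_L T_R q.1 q.2 := by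
  set D := hP.reversedDrift N with hD
  have hv₁ := hP.bathVecL_mem_reversedDrift_noise N T_L
  have hv₂ := hP.bathVecR_mem_reversedDrift_noise N T_R
  exact D.toConfinedDrift.measurable_sdeKernel hv₁ hv₂

/-- `(y, s) ↦ ∫ g dP̂_{s⁺}(y, ·)` is measurable for measurable `g ≥ 0`. [folklore] -/
theorem measurable_lintegral_revKernel (hP : P.IsConfining) {g : PhaseSpace N → ℝ≥0∞} (hg : Measurable g) :
    Measurable fun p : PhaseSpace N × ℝ => ∫⁻ x, g x ∂(P.langevinRevKernel N T_L T_R p.2.toNNReal p.1) := by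
  have h2 : Measurable fun p : PhaseSpace N × ℝ => (p.2.toNNReal, p.1) :=
    (measurable_real_toNNReal.comp measurable_snd).prodMk measurable_fst
  have h3 := (measurable_langevinRevKernel T_L T_R hP).comp h2
  exact (Measure.measurable_lintegral hg).comp h3

/-- **The integrated Duhamel bound**: for `f ∈ C²_c` with defect `E = L̂ f + 2γ f` and `t ≥ 0`,
`∫ |e^{2γt} ∫ f dP̂_t(y,·) - f(y)| dy ≤ e^{2γt} · t · ∫ |E| dx` (as an inequality of Lebesgue integrals).
[folklore] -/
theorem lintegral_abs_duhamel_le (hP : P.IsConfining) (hU : ContDiff ℝ ((⊤ : ℕ∞) : WithTop ℕ∞) P.U)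
    (hV : ContDiff ℝ ((⊤ : ℕ∞) : WithTop ℕ∞) P.V) (hN : 0 < N)
    {f : PhaseSpace N → ℝ} (hf : ContDiff ℝ 2 f) (hfc : HasCompactSupport f) (t : ℝ≥0) :
    ∫⁻ y, ENNReal.ofReal |Real.exp (2 * P.γ * t) * ∫ x, f x ∂(P.langevinRevKernel N T_L T_R t y) - f y| ≤
      ENNReal.ofReal (Real.exp (2 * P.γ * t)) * t *
        ∫⁻ x, ENNReal.ofReal |sdeGenerator (fun z => -P.drift N z) (P.bathVecL N T_L) (P.bathVecR N T_R) f x +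
          2 * P.γ * f x| := by
  set κ : ℝ≥0 → Kernel (PhaseSpace N) (PhaseSpace N) := P.langevinRevKernel N T_L T_R with hκ
  haveI hprob : ∀ s z, IsProbabilityMeasure (κ s z) := fun s z =>
    isProbabilityMeasure_langevinRevKernel hP N T_L T_R s z
  set c := 2 * P.γ with hc
  set E : PhaseSpace N → ℝ := fun x =>
    sdeGenerator (fun z => -P.drift N z) (P.bathVecL N T_L) (P.bathVecR N T_R) f x + c * f x with hE
  have hYc : Continuous fun z => -P.drift N z := (hP.reversedDrift N).contDiff_drift.continuous
  have hEc : Continuous E := (continuous_sdeGenerator _ _ hYc hf).add (continuous_const.mul hf.continuous)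
  obtain ⟨Cf, hCf⟩ := hf.continuous.bounded_above_of_compact_support hfc
  obtain ⟨CL, hCL⟩ := exists_bound_sdeGenerator (P.bathVecL N T_L) (P.bathVecR N T_R) hYc hf hfc
  have hEb : ∀ x, ‖E x‖ ≤ CL + |c| * Cf := fun x => by
    calc ‖E x‖ ≤ ‖sdeGenerator (fun z => -P.drift N z) (P.bathVecL N T_L) (P.bathVecR N T_R) f x‖ + ‖c * f x‖ :=
          norm_add_le _ _
      _ ≤ CL + |c| * Cf := by
          rw [norm_mul, Real.norm_eq_abs]
          exact add_le_add (hCL x) (mul_le_mul_of_nonneg_left (hCf x) (abs_nonneg c))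
  have hct : 0 ≤ c * t := by have := hP.γ_nonneg; have := t.coe_nonneg; positivity
  -- the absolute defect transported by the reversed kernels
  set a : ℝ → PhaseSpace N → ℝ := fun s y => ∫ x, |E x| ∂(κ s.toNNReal y) with ha
  have ha0 : ∀ s y, 0 ≤ a s y := fun s y => integral_nonneg fun x => abs_nonneg _
  have hac : ∀ y, Continuous fun s => a s y := fun y =>
    continuous_integral_langevinRevKernel hP N T_L T_R y hEc.abs (C := CL + |c| * Cf) fun x => by
      rw [Real.norm_eq_abs, abs_abs, ← Real.norm_eq_abs]; exact hEb x
  -- pointwise: `|e^{ct} P̂_t f - f| ≤ e^{ct} ∫₀ᵗ a(s, y) ds`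
  have hpt : ∀ y, |Real.exp (c * t) * ∫ x, f x ∂(κ t y) - f y| ≤
      Real.exp (c * t) * ∫ s in (0:ℝ)..(t:ℝ), a s y := by
    intro y
    rw [revKernel_duhamel T_L T_R hP hf hfc t y]
    have hle : ∀ s ∈ Set.Icc (0:ℝ) t, ‖Real.exp (c * s) * ∫ x, E x ∂(κ s.toNNReal y)‖ ≤ Real.exp (c * t) * a s y := by
      intro s hs
      rw [norm_mul, Real.norm_eq_abs, abs_of_pos (Real.exp_pos _)]
      refine mul_le_mul (Real.exp_le_exp.2 ?_) ?_ (norm_nonneg _) (Real.exp_pos _).le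
      · have := hP.γ_nonneg
        exact mul_le_mul_of_nonneg_left hs.2 (by positivity)
      · rw [Real.norm_eq_abs]
        exact abs_integral_le_integral_abs
    calc |∫ s in (0:ℝ)..(t:ℝ), Real.exp (c * s) * ∫ x, E x ∂(κ s.toNNReal y)|
        ≤ ∫ s in (0:ℝ)..(t:ℝ), Real.exp (c * t) * a s y := by
          rw [← Real.norm_eq_abs]
          refine intervalIntegral.norm_integral_le_of_norm_le t.coe_nonneg ?_ ?_
          · exact Eventually.of_forall fun s hs => hle s ⟨hs.1.le, hs.2⟩
          · exact (continuous_const.mul (hac y)).intervalIntegrable _ _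
      _ = Real.exp (c * t) * ∫ s in (0:ℝ)..(t:ℝ), a s y := by
          rw [intervalIntegral.integral_const_mul]
  -- convert the inner time integral to a Lebesgue integral over `Ioc 0 t`
  have hconv : ∀ y, ENNReal.ofReal (Real.exp (c * t) * ∫ s in (0:ℝ)..(t:ℝ), a s y) =
      ENNReal.ofReal (Real.exp (c * t)) * ∫⁻ s in Set.Ioc (0:ℝ) t, ENNReal.ofReal (a s y) := by
    intro y
    rw [ENNReal.ofReal_mul (Real.exp_pos _).le, intervalIntegral.integral_of_le t.coe_nonneg,
      ofReal_integral_eq_lintegral_ofReal]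
    · exact ((hac y).integrableOn_Icc).mono_set Set.Ioc_subset_Icc_self
    · exact Eventually.of_forall fun s => ha0 s y
  -- `a(s, y)` as a Lebesgue integral, and its measurability in `(y, s)`
  have ha_eq : ∀ s y, ENNReal.ofReal (a s y) = ∫⁻ x, ENNReal.ofReal |E x| ∂(κ s.toNNReal y) := by
    intro s y
    rw [ha]
    exact ofReal_integral_eq_lintegral_ofReal
      ((integrable_const (CL + |c| * Cf)).mono' hEc.abs.aestronglyMeasurable
        (Eventually.of_forall fun x => by rw [Real.norm_eq_abs, abs_abs, ← Real.norm_eq_abs]; exact hEb x))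
      (Eventually.of_forall fun x => abs_nonneg _)
  have hmeasE : Measurable fun x => ENNReal.ofReal |E x| := hEc.abs.measurable.ennreal_ofReal
  have hmeas : Measurable fun p : PhaseSpace N × ℝ => ENNReal.ofReal (a p.2 p.1) := by
    have e : (fun p : PhaseSpace N × ℝ => ENNReal.ofReal (a p.2 p.1)) =
        fun p => ∫⁻ x, ENNReal.ofReal |E x| ∂(P.langevinRevKernel N T_L T_R p.2.toNNReal p.1) :=
      funext fun p => ha_eq p.2 p.1
    rw [e]
    exact measurable_lintegral_revKernel T_L T_R hP hmeasE
  -- the `y`-integral of `a(s, ·)` is at most `‖E‖₁` for `s > 0`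
  have hslice : ∀ s : ℝ, 0 < s → ∫⁻ y, ENNReal.ofReal (a s y) ≤ ∫⁻ x, ENNReal.ofReal |E x| := by
    intro s hs
    simp_rw [ha_eq]
    exact lintegral_revKernel_le T_L T_R hP hU hV hN (t := s.toNNReal) (Real.toNNReal_pos.2 hs) hmeasE
  -- assemble with Tonelli
  calc ∫⁻ y, ENNReal.ofReal |Real.exp (c * t) * ∫ x, f x ∂(κ t y) - f y|
      ≤ ∫⁻ y, ENNReal.ofReal (Real.exp (c * t)) * ∫⁻ s in Set.Ioc (0:ℝ) t, ENNReal.ofReal (a s y) := by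
        refine lintegral_mono fun y => ?_
        rw [← hconv y]
        exact ENNReal.ofReal_le_ofReal (hpt y)
    _ = ENNReal.ofReal (Real.exp (c * t)) * ∫⁻ y, ∫⁻ s in Set.Ioc (0:ℝ) t, ENNReal.ofReal (a s y) :=
        lintegral_const_mul' _ _ ENNReal.ofReal_ne_top
    _ = ENNReal.ofReal (Real.exp (c * t)) * ∫⁻ s in Set.Ioc (0:ℝ) t, ∫⁻ y, ENNReal.ofReal (a s y) := by
        rw [lintegral_lintegral_swap hmeas.aemeasurable]
    _ ≤ ENNReal.ofReal (Real.exp (c * t)) * ∫⁻ _ in Set.Ioc (0:ℝ) t, ∫⁻ x, ENNReal.ofReal |E x| :=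
        mul_le_mul_right (setLIntegral_mono' measurableSet_Ioc fun s hs => hslice s hs.1) _
    _ = ENNReal.ofReal (Real.exp (c * t)) * t * ∫⁻ x, ENNReal.ofReal |E x| := by
        rw [setLIntegral_const, Real.volume_Ioc, sub_zero, ENNReal.ofReal_coe_nnreal]
        ring

end Duhamel

end Summit.AtomisticToContinuum.FouriersLaw.Theorems.NessUnique

end
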